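import Mathlib
import HarnessLib
import Summits.ResolutionOfSingularities.ResolutionOfSingularities.Theorems.WildQuotientsWildQuotientResolutionS1aRootNodeAway
import Summits.ResolutionOfSingularities.ResolutionOfSingularities.Theorems.WildQuotientsWildQuotientResolutionS1aKillFreeRefine
import Summits.ResolutionOfSingularities.ResolutionOfSingularities.Theorems.WildQuotientsWildQuotientResolutionS1aKillFreeCert
import Summits.ResolutionOfSingularities.ResolutionOfSingularities.Theorems.WildQuotientsWildQuotientResolutionS1aTerminalReachLower

/-!
# S1a — PRINCIPAL AUGMENTATION IDEAL on a polynomial chart ⇒ `KillsIn 0`: the carried formal locus of the refined initial atlas is EMPTY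

[OURS · L1 W4.5c · leafhand-res-wildquotients-9 g1; SUCCESSOR-BRIEF-v2 §3 caveat E-T («F = ∅ = KillsIn 0» vs `Terminal`)] — NOT statements of the manuscript;
counted 0; AI-level work, weaker than expert review. Crux stmt-ResolutionOfSingularities-17941 `CyclicQuotientFourfolds`, line `s1a-logminvertex` v13
(`stub_reachLowerInFX`). A CLASS of the research stub, not the stub.

Companion of ✓`terminal_initial_of_isPrincipal_augmentationIdeal` (`…S1aPrincipalAugmentationTerminal`: principal augmentation ⇒ TERMINAL, via global
Király–Lütkebohmert). Here the SAME hypothesis gives the frame's STRONGER leaf notion `KillsIn 0` — some node atlas with EMPTY carried formal locus: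
adjoin to the plain atlas `ofNodeAtlas h₀` the single polynomial chart `X′ = D(1)` with its node (✓`exists_rootNodeAway` with `hh = 1`: trivial grading,
`σ` localised at `1`); its augmentation ideal is principal (✓`augmentationIdeal_conj`, ✓`isPrincipal_augmentationIdeal_sigmaAway`), so the chart is
PRINCIPAL NEAR every point (✓`NodeData.principalNear_of_certificate` with the generator as `β̃`, `c = 1`, `k = 0`), and ✓`fLocus_adjoin_of_forall`
empties the formal locus. So for data killed at depth 0 the two leaf notions of caveat E-T AGREE: `augIdeal principal ⇒ F = ∅ (KillsIn 0) ⇒ Terminal`.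
* ★ `killsIn_zero_initial_of_isPrincipal_augmentationIdeal` — census coordinates `e : Γ(X′, ⊤) ≃+* k[x_ι]`, `σ^[p] = id`, `augmentationIdeal σ` principal
  ⇒ `KillsIn 0 (initial)`;
* `exists_reachLowerF_initial_of_isPrincipal_augmentationIdeal'` — the research-stub clause through ✓`exists_reachLowerF_of_killsIn_zero`.
-/

set_option linter.dupNamespace false

noncomputable section

open CategoryTheory Limits AlgebraicGeometry TopologicalSpace Topology Opposite MvPolynomial
open Literature.AlgebraicGeometry.Resolution Literature.AlgebraicGeometry.RelativeSpec
open Summit.ResolutionOfSingularities.ResolutionOfSingularities.Theorems.WildQuotientResolution.S1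
open Summit.ResolutionOfSingularities.ResolutionOfSingularities.Theorems.WildQuotientResolution.S1.NodeAtlas
open Summit.ResolutionOfSingularities.ResolutionOfSingularities.Theorems.WildQuotientResolution.S1.ProducerStep
open Summit.ResolutionOfSingularities.ResolutionOfSingularities.Theorems.WildQuotientResolution.S1.NpFrame
open Summit.ResolutionOfSingularities.ResolutionOfSingularities.Theorems.WildQuotientResolution.S1.GoodCharts
open Summit.ResolutionOfSingularities.ResolutionOfSingularities.Theorems.WildQuotientResolution.S1.NodeAway
open Summit.ResolutionOfSingularities.ResolutionOfSingularities.Theorems.WildQuotientResolution.S1.NodeChartAway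
open Summit.ResolutionOfSingularities.ResolutionOfSingularities.Theorems.WildQuotientResolution.S1.NodeTransport
open Summit.ResolutionOfSingularities.ResolutionOfSingularities.Theorems.WildQuotientResolution.S1.BlowupCharts

namespace Summit.ResolutionOfSingularities.ResolutionOfSingularities.Theorems.WildQuotientResolution.S1.GameFrame.GModel

variable {p : ℕ} {X' X₁ : Scheme.{0}} {q : X' ⟶ X₁} {G : Type} [Group G] {ρ : G →* Aut X'} {g₀ : G}

set_option maxHeartbeats 800000 in -- the node-data records of `exists_rootNodeAway` are heavy to unify (cf. that theorem's 1600000)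
/-- ★ **PRINCIPAL AUGMENTATION IDEAL ⇒ `KillsIn 0`.** Let `(X′, X₁, q, ρ, g₀)` be action data with `X′` AFFINE, integral, locally Noetherian, `q` affine and
`G`-invariant, `G = ⟨g₀⟩`, and `e : Γ(X′, ⊤) ≃+* k[x_ι]` a polynomial chart intertwining `g₀` with a ring automorphism `σ` with `σ^[p] = id`. If
`augmentationIdeal σ` is PRINCIPAL then the initial model satisfies `KillsIn 0`: the plain atlas refined by the chart `X′ = D(1)` with its (trivially graded)
node has EMPTY carried formal locus. [OURS · L1 W4.5c · depth-0 kill, `F = ∅` form; NOT a statement of the manuscript] -/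
theorem killsIn_zero_initial_of_isPrincipal_augmentationIdeal [Finite G] (hG : ∀ g : G, g ∈ Subgroup.zpowers g₀)
    (hq : ∀ g : G, (ρ g).hom ≫ q = q) [IsIntegral X'] [IsLocallyNoetherian X'] [IsAffine X'] [IsAffineHom q]
    {k : Type} [Field k] {ι : Type} [Fintype ι] [DecidableEq ι] (σ : MvPolynomial ι k ≃+* MvPolynomial ι k)
    (hσp : ∀ a : MvPolynomial ι k, (⇑σ)^[p] a = a) (hI : (augmentationIdeal σ).IsPrincipal)
    (e : Γ(X', ⊤) ≃+* MvPolynomial ι k)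
    (hστ : ∀ t : Γ(X', ⊤), e ((ρ g₀⁻¹).hom.appLE ⊤ ⊤ (by rw [Scheme.Hom.preimage_top]) t) = σ (e t))
    (h₀ : NodeAtlas p (⟨ρ, hq⟩ : ActionOver q G) g₀) :
    KillsIn 0 (GModel.initial (p := p) (g₀ := g₀) hq h₀) := by
  classical
  -- the one chart: all of `X′`, affine over `X₁`
  haveI : IsAffine (⊤ : X'.Opens) := isAffineOpen_top X'
  have hAff : IsAffineHom ((⊤ : X'.Opens).ι ≫ q) := inferInstance
  have hst : ∀ g : G, (ρ g).hom ⁻¹ᵁ (⊤ : X'.Opens) = ⊤ := fun g => Scheme.Hom.preimage_top _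
  let M : GModel p q G ρ g₀ := GModel.initial (p := p) (g₀ := g₀) hq h₀
  let O : M.act.StableAffineOpens := ⟨⊤, hst, hAff⟩
  have hO : IsAffineOpen O.1 := isAffineOpen_top X'
  have hact : ∀ t : Γ(M.V, O.1), actOEquiv M.act O g₀ t = e.symm (σ (e t)) := fun t => by
    apply e.injective
    rw [e.apply_symm_apply, ← hστ]
    rfl
  -- the node of `D(1) = X′` with its localised polynomial model
  have hσ1 : σ 1 = 1 := map_one σ
  obtain ⟨DW, Φ, -, hconj, -⟩ := exists_rootNodeAway (p := p) hG M O hO e σ hact hσp 1 hσ1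
  letI := DW.instCommRing
  letI := DW.instGradedRing
  have hb : ∀ g : G, actO M.act O g (e.symm 1) = e.symm 1 := actO_symm_eq_of_fixed hG M O e σ hact 1 hσ1
  -- its augmentation ideal is principal: `DW.σ y = Φ⁻¹ (σ₁ (Φ y))` with `σ₁ = σ` localised at `1`, whose augmentation ideal is `(ν)`
  have hDWσ : ∀ y : DW.B, DW.σ y = Φ.symm (sigmaAway σ hσ1 (Φ y)) := fun y => by
    apply Φ.injective
    rw [Φ.apply_symm_apply]
    have := hconj (Φ y)
    rwa [Φ.symm_apply_apply] at this
  obtain ⟨ν, hν⟩ := isPrincipal_augmentationIdeal_sigmaAway σ hσ1 hI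
  have hmemν : ∀ x, x ∈ augmentationIdeal (sigmaAway σ hσ1) ↔ ∃ c, c * ν = x := fun x => by
    rw [hν]; exact Ideal.mem_span_singleton'
  let β : DW.B := Φ.symm ν
  -- (i) `aug DW.σ ≤ (β)`
  have hFD1 : augmentationIdeal DW.σ ≤ Ideal.span {β} := by
    rw [augmentationIdeal, Ideal.span_le]
    rintro _ ⟨y, rfl⟩
    have hy : sigmaAway σ hσ1 (Φ y) - Φ y ∈ augmentationIdeal (sigmaAway σ hσ1) := sub_mem_augmentationIdeal _ _
    obtain ⟨c, hc⟩ := (hmemν _).mp hy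
    change DW.σ y - y ∈ Ideal.span {β}
    rw [hDWσ, Ideal.mem_span_singleton']
    refine ⟨Φ.symm c, ?_⟩
    apply Φ.injective
    rw [map_mul, Φ.apply_symm_apply, map_sub, Φ.apply_symm_apply, Φ.apply_symm_apply, hc]
  -- (ii) `β ∈ aug DW.σ`
  have hβmem : β ∈ augmentationIdeal DW.σ := by
    have hν1 : ν ∈ augmentationIdeal (sigmaAway σ hσ1) := (hmemν ν).mpr ⟨1, one_mul ν⟩
    -- `Φ⁻¹` maps `aug σ₁` into `aug DW.σ` (generators to generators)
    have hle : (augmentationIdeal (sigmaAway σ hσ1)).map (Φ.symm : _ →+* DW.B) ≤ augmentationIdeal DW.σ := by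
      rw [augmentationIdeal, Ideal.map_span, Ideal.span_le]
      rintro _ ⟨_, ⟨x, rfl⟩, rfl⟩
      rw [SetLike.mem_coe, RingHom.coe_coe, map_sub]
      have : Φ.symm (sigmaAway σ hσ1 x) = DW.σ (Φ.symm x) := by rw [hDWσ, Φ.apply_symm_apply]
      rw [this]
      exact sub_mem_augmentationIdeal _ _
    exact hle (Ideal.mem_map_of_mem _ hν1)
  -- hence PRINCIPAL NEAR every point of the chart (certificate `c = 1`, `k = 0`, `β̃` = the generator)
  set O' := basicOpenStable M.act O hO hb with hO'
  have hall : ∀ u ∈ O'.1, DW.PrincipalNear u := by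
    intro u hu
    refine DW.principalNear_of_certificate hG β hFD1 (1 : Γ(M.V, O'.1)) (u := u) ?_ (k := 0) ?_
    · exact (Scheme.mem_basicOpen _ (1 : Γ(M.V, O'.1)) u hu).mpr (by rw [map_one]; exact isUnit_one)
    · rw [pow_zero, mul_one]; exact hβmem
  -- the refined atlas has empty carried formal locus: `F = F_old \ D(1)` and `D(1) = X′`
  refine ⟨(NodeAtlasData.ofNodeAtlas (p := p) (ρ := M.act) (g₀ := g₀) h₀).adjoin O' DW, ?_⟩
  rw [NodeAtlasData.fLocus_adjoin_of_forall _ O' DW hall, Set.sdiff_eq_empty]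
  intro u _
  have h1 : e.symm 1 = 1 := map_one _
  change u ∈ M.V.basicOpen (e.symm 1)
  exact (Scheme.mem_basicOpen _ (e.symm 1) u (Opens.mem_top u)).mpr (by rw [h1, map_one]; exact isUnit_one)

/-- **… hence the research-stub clause** (every root decoration), through ✓`exists_reachLowerF_of_killsIn_zero` (`q` finite, `X₁ → Spec k′` locally of finite type).
[OURS · L1 W4.5c · depth-0 kill; NOT a statement of the manuscript] -/
theorem exists_reachLowerF_initial_of_isPrincipal_augmentationIdeal' [Finite G] (hp : p.Prime) (hG : ∀ g : G, g ∈ Subgroup.zpowers g₀)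
    (hq : ∀ g : G, (ρ g).hom ≫ q = q) [IsIntegral X'] [IsLocallyNoetherian X'] [IsAffine X'] [IsFinite q]
    {k' : Type} [Field k'] (φ : X₁ ⟶ Spec (.of k')) [LocallyOfFiniteType φ]
    {k : Type} [Field k] {ι : Type} [Fintype ι] [DecidableEq ι] (σ : MvPolynomial ι k ≃+* MvPolynomial ι k)
    (hσp : ∀ a : MvPolynomial ι k, (⇑σ)^[p] a = a) (hI : (augmentationIdeal σ).IsPrincipal)
    (e : Γ(X', ⊤) ≃+* MvPolynomial ι k)
    (hστ : ∀ t : Γ(X', ⊤), e ((ρ g₀⁻¹).hom.appLE ⊤ ⊤ (by rw [Scheme.Hom.preimage_top]) t) = σ (e t))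
    (h₀ : NodeAtlas p (⟨ρ, hq⟩ : ActionOver q G) g₀) (𝔄₀ : NodeAtlasData p (GModel.initial hq h₀).act g₀) :
    ∃ P : ∀ M : GModel p q G ρ g₀, NodeAtlasData p M.act g₀ → Prop,
      P (GModel.initial hq h₀) 𝔄₀ ∧ ∀ (M : GModel p q G ρ g₀) (𝔄 : NodeAtlasData p M.act g₀), P M 𝔄 → ¬ M.Terminal →
        ∃ n : ℕ, TreeF P (fun N 𝔅 => LexLTF N 𝔅 M 𝔄) n M 𝔄 :=
  exists_reachLowerF_of_killsIn_zero hp hG _ (hasNoetherianBase_of_datum φ _) 𝔄₀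
    (killsIn_zero_initial_of_isPrincipal_augmentationIdeal hG hq σ hσp hI e hστ h₀)

end Summit.ResolutionOfSingularities.ResolutionOfSingularities.Theorems.WildQuotientResolution.S1.GameFrame.GModel

/-! ## Appendix (leafhand-res-wildquotients-9 g1, same session): augmentation ideals from generators; the TRANSLATION CLASS is `KillsIn 0` -/

namespace Summit.ResolutionOfSingularities.ResolutionOfSingularities.Theorems.WildQuotientResolution.S1.TranslationClass

/-- **Augmentation ideals are generated on ring generators**: if `σ s − s ∈ I` for all `s` in a set `S` generating `B` as a ring, then
`σ b − b ∈ I` for every `b` (`σ(bc) − bc = σb·(σc − c) + (σb − b)·c`). [folklore] -/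
theorem sub_mem_of_mem_closure {B : Type*} [CommRing B] (σ : B ≃+* B) (I : Ideal B) (S : Set B)
    (hS : ∀ s ∈ S, σ s - s ∈ I) {b : B} (hb : b ∈ Subring.closure S) : σ b - b ∈ I := by
  induction hb using Subring.closure_induction with
  | mem x hx => exact hS x hx
  | zero => rw [map_zero, sub_zero]; exact I.zero_mem
  | one => rw [map_one, sub_self]; exact I.zero_mem
  | add x y _ _ hx hy =>
    have : σ (x + y) - (x + y) = (σ x - x) + (σ y - y) := by rw [map_add]; ring
    rw [this]; exact I.add_mem hx hy
  | neg x _ hx =>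
    have : σ (-x) - -x = -(σ x - x) := by rw [map_neg]; ring
    rw [this]; exact I.neg_mem hx
  | mul x y _ _ hx hy =>
    have : σ (x * y) - x * y = σ x * (σ y - y) + (σ x - x) * y := by rw [map_mul]; ring
    rw [this]; exact I.add_mem (I.mul_mem_left _ hy) (I.mul_mem_right _ hx)

/-- **The augmentation ideal is generated by the `σ s − s`, `s` ranging over ring generators.** [folklore] -/
theorem augmentationIdeal_le_of_generators {B : Type*} [CommRing B] (σ : B ≃+* B) (I : Ideal B) (S : Set B)
    (hgen : Subring.closure S = ⊤) (hS : ∀ s ∈ S, σ s - s ∈ I) : augmentationIdeal σ ≤ I := by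
  rw [augmentationIdeal, Ideal.span_le]
  rintro _ ⟨b, rfl⟩
  exact sub_mem_of_mem_closure σ I S hS (hgen ▸ Subring.mem_top b)

/-- **The augmentation ideal of a TRANSLATION is principal**: `σ` a ring automorphism of `k[x_0,…,x_n]` fixing constants and `x_0,…,x_{n−1}` with
`σ x_n = x_n + F` ⇒ `augmentationIdeal σ = (F)`. [folklore] -/
theorem augmentationIdeal_translation_eq_span {k : Type} [Field k] (n : ℕ) (F : MvPolynomial (Fin (n + 1)) k)
    (σ : MvPolynomial (Fin (n + 1)) k ≃+* MvPolynomial (Fin (n + 1)) k) (hC : ∀ a : k, σ (C a) = C a)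
    (hfix : ∀ i : Fin n, σ (X (Fin.castSucc i)) = X (Fin.castSucc i)) (hlast : σ (X (Fin.last n)) = X (Fin.last n) + F) :
    augmentationIdeal σ = Ideal.span {F} := by
  apply le_antisymm
  · refine augmentationIdeal_le_of_generators σ _ (Set.range (C : k → MvPolynomial (Fin (n + 1)) k) ∪ Set.range X) ?_ ?_
    · -- `k[x]` is generated by constants and variables
      have h := Algebra.adjoin_eq_ring_closure (R := k) (Set.range (X : Fin (n + 1) → MvPolynomial (Fin (n + 1)) k))
      rw [adjoin_range_X] at h
      rw [← show (algebraMap k (MvPolynomial (Fin (n + 1)) k) : k → MvPolynomial (Fin (n + 1)) k) = C from rfl, ← h]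
      rfl
    · rintro _ (⟨a, rfl⟩ | ⟨i, rfl⟩)
      · rw [hC, sub_self]; exact Ideal.zero_mem _
      · cases i using Fin.lastCases with
        | last => rw [hlast, add_sub_cancel_left]; exact Ideal.mem_span_singleton_self F
        | cast j => rw [hfix, sub_self]; exact Ideal.zero_mem _
  · rw [Ideal.span_le, Set.singleton_subset_iff, SetLike.mem_coe, show F = σ (X (Fin.last n)) - X (Fin.last n) by rw [hlast]; ring]
    exact sub_mem_augmentationIdeal σ _

end Summit.ResolutionOfSingularities.ResolutionOfSingularities.Theorems.WildQuotientResolution.S1.TranslationClass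

namespace Summit.ResolutionOfSingularities.ResolutionOfSingularities.Theorems.WildQuotientResolution.S1.GameFrame.GModel

variable {p : ℕ} {X' X₁ : Scheme.{0}} {q : X' ⟶ X₁} {G : Type} [Group G] {ρ : G →* Aut X'} {g₀ : G}

/-- **Translations have order `p` automatically**: `σ` fixing constants and `x_0,…,x_{n−1}` with `σ x_n = x_n + F(x_0,…,x_{n−1})` satisfies `σ^[p] = id`
in characteristic `p`. [folklore] -/
theorem iterate_translation_eq_self {k : Type} [Field k] (p : ℕ) [CharP k p] (n : ℕ) (F : MvPolynomial (Fin n) k)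
    (σ : MvPolynomial (Fin (n + 1)) k ≃+* MvPolynomial (Fin (n + 1)) k) (hC : ∀ a : k, σ (C a) = C a)
    (hfix : ∀ i : Fin n, σ (X (Fin.castSucc i)) = X (Fin.castSucc i))
    (hlast : σ (X (Fin.last n)) = X (Fin.last n) + rename Fin.castSucc F) (b : MvPolynomial (Fin (n + 1)) k) :
    (⇑σ)^[p] b = b := by
  -- `σ` fixes `F̃ = rename castSucc F`
  have hσF : σ (rename Fin.castSucc F) = rename Fin.castSucc F := by
    have h : (σ : MvPolynomial (Fin (n + 1)) k →+* MvPolynomial (Fin (n + 1)) k).comp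
        ((rename Fin.castSucc : MvPolynomial (Fin n) k →ₐ[k] MvPolynomial (Fin (n + 1)) k) :
          MvPolynomial (Fin n) k →+* MvPolynomial (Fin (n + 1)) k) =
        ((rename Fin.castSucc : MvPolynomial (Fin n) k →ₐ[k] MvPolynomial (Fin (n + 1)) k) :
          MvPolynomial (Fin n) k →+* MvPolynomial (Fin (n + 1)) k) := by
      refine MvPolynomial.ringHom_ext (fun a => ?_) (fun i => ?_)
      · simp only [RingHom.coe_comp, RingHom.coe_coe, Function.comp_apply, rename_C]; exact hC a
      · simp only [RingHom.coe_comp, RingHom.coe_coe, Function.comp_apply, rename_X]; exact hfix i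
    exact DFunLike.congr_fun h F
  -- iterates on the last variable
  have hit : ∀ m : ℕ, (⇑σ)^[m] (X (Fin.last n)) = X (Fin.last n) + (m : MvPolynomial (Fin (n + 1)) k) * rename Fin.castSucc F := by
    intro m
    induction m with
    | zero => simp
    | succ m ih =>
      rw [Function.iterate_succ_apply', ih, map_add, map_mul, hlast, hσF, map_natCast]
      push_cast; ring
  -- `σ^p` agrees with the identity on generators
  have h : ((σ ^ p : MvPolynomial (Fin (n + 1)) k ≃+* MvPolynomial (Fin (n + 1)) k) :
      MvPolynomial (Fin (n + 1)) k →+* MvPolynomial (Fin (n + 1)) k) = RingHom.id _ := by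
    refine MvPolynomial.ringHom_ext (fun a => ?_) (fun i => ?_)
    · rw [RingHom.coe_coe, RingAut.coe_pow, RingHom.id_apply]
      exact Function.iterate_fixed (hC a) p
    · rw [RingHom.coe_coe, RingAut.coe_pow, RingHom.id_apply]
      cases i using Fin.lastCases with
      | last => rw [hit, CharP.cast_eq_zero, zero_mul, add_zero]
      | cast j => exact Function.iterate_fixed (hfix j) p
  have := DFunLike.congr_fun h b
  rwa [RingHom.coe_coe, RingAut.coe_pow, RingHom.id_apply] at this

/-- ★ **THE TRANSLATION CLASS IS KILLED AT DEPTH 0 IN THE `F = ∅` SENSE TOO**: `σ` on `k[x_0,…,x_n]` fixing constants and `x_0,…,x_{n−1}`,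
`x_n ↦ x_n + F(x_0,…,x_{n−1})` (any `F`, `k` of characteristic `p`) ⇒ `KillsIn 0 (initial)` — the augmentation ideal is `(F)`
(`TranslationClass.augmentationIdeal_translation_eq_span`), `σ^[p] = id` is automatic (`iterate_translation_eq_self`), and
✓`killsIn_zero_initial_of_isPrincipal_augmentationIdeal` applies. (Compare ✓`translationMv_terminal_initial`: TERMINAL with polynomial invariants.)
[OURS · L1 W4.5c · class `r = 0` translation, `F = ∅` form; NOT a statement of the manuscript] -/
theorem translationMv_killsIn_zero [Finite G] (hG : ∀ g : G, g ∈ Subgroup.zpowers g₀)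
    (hq : ∀ g : G, (ρ g).hom ≫ q = q) [IsIntegral X'] [IsLocallyNoetherian X'] [IsAffine X'] [IsAffineHom q]
    {k : Type} [Field k] [CharP k p] (n : ℕ) (F : MvPolynomial (Fin n) k)
    (σ : MvPolynomial (Fin (n + 1)) k ≃+* MvPolynomial (Fin (n + 1)) k) (hC : ∀ a : k, σ (C a) = C a)
    (hfix : ∀ i : Fin n, σ (X (Fin.castSucc i)) = X (Fin.castSucc i))
    (hlast : σ (X (Fin.last n)) = X (Fin.last n) + rename Fin.castSucc F)
    (e : Γ(X', ⊤) ≃+* MvPolynomial (Fin (n + 1)) k)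
    (hστ : ∀ t : Γ(X', ⊤), e ((ρ g₀⁻¹).hom.appLE ⊤ ⊤ (by rw [Scheme.Hom.preimage_top]) t) = σ (e t))
    (h₀ : NodeAtlas p (⟨ρ, hq⟩ : ActionOver q G) g₀) :
    KillsIn 0 (GModel.initial (p := p) (g₀ := g₀) hq h₀) := by
  classical
  refine killsIn_zero_initial_of_isPrincipal_augmentationIdeal hG hq σ
    (iterate_translation_eq_self p n F σ hC hfix hlast) ⟨⟨rename Fin.castSucc F, ?_⟩⟩ e hστ h₀
  exact TranslationClass.augmentationIdeal_translation_eq_span n (rename Fin.castSucc F) σ hC hfix hlast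

/-- **… hence the research-stub clause through the `KillsIn` route** (every root decoration; `q` finite, `X₁ → Spec k′` locally of finite type).
[OURS · L1 W4.5c · class `r = 0` translation; NOT a statement of the manuscript] -/
theorem exists_reachLowerF_initial_of_translationMv' [Finite G] (hp : p.Prime) (hG : ∀ g : G, g ∈ Subgroup.zpowers g₀)
    (hq : ∀ g : G, (ρ g).hom ≫ q = q) [IsIntegral X'] [IsLocallyNoetherian X'] [IsAffine X'] [IsFinite q]
    {k' : Type} [Field k'] (φ : X₁ ⟶ Spec (.of k')) [LocallyOfFiniteType φ]
    {k : Type} [Field k] [CharP k p] (n : ℕ) (F : MvPolynomial (Fin n) k)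
    (σ : MvPolynomial (Fin (n + 1)) k ≃+* MvPolynomial (Fin (n + 1)) k) (hC : ∀ a : k, σ (C a) = C a)
    (hfix : ∀ i : Fin n, σ (X (Fin.castSucc i)) = X (Fin.castSucc i))
    (hlast : σ (X (Fin.last n)) = X (Fin.last n) + rename Fin.castSucc F)
    (e : Γ(X', ⊤) ≃+* MvPolynomial (Fin (n + 1)) k)
    (hστ : ∀ t : Γ(X', ⊤), e ((ρ g₀⁻¹).hom.appLE ⊤ ⊤ (by rw [Scheme.Hom.preimage_top]) t) = σ (e t))
    (h₀ : NodeAtlas p (⟨ρ, hq⟩ : ActionOver q G) g₀) (𝔄₀ : NodeAtlasData p (GModel.initial hq h₀).act g₀) :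
    ∃ P : ∀ M : GModel p q G ρ g₀, NodeAtlasData p M.act g₀ → Prop,
      P (GModel.initial hq h₀) 𝔄₀ ∧ ∀ (M : GModel p q G ρ g₀) (𝔄 : NodeAtlasData p M.act g₀), P M 𝔄 → ¬ M.Terminal →
        ∃ n : ℕ, TreeF P (fun N 𝔅 => LexLTF N 𝔅 M 𝔄) n M 𝔄 :=
  exists_reachLowerF_of_killsIn_zero hp hG _ (hasNoetherianBase_of_datum φ _) 𝔄₀
    (translationMv_killsIn_zero hG hq n F σ hC hfix hlast e hστ h₀)

end Summit.ResolutionOfSingularities.ResolutionOfSingularities.Theorems.WildQuotientResolution.S1.GameFrame.GModel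

end
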